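import Summits.QuantumFields.YangMills.Theorems.BalabanLadderUVSeamRecClassicalResponseTempering
import Summits.QuantumFields.YangMills.Theorems.BalabanLadderUVSeamRecCeilingsDLRPeelingSemiclassical
import HarnessLib

/-!
# Crux `UVSeamRec` (stmt-QuantumFields-20043): the classical split (split-cl) holds AT EVERY FIXED SCALE —
# Laplace's principle on the compact fibre, uniformly on the closed low-response set of exteriors

Helper file (`--supports stmt-QuantumFields-20043`) of the LEAD seat `ym-spine-20043-p1` (gen 10); sequel of the LEAD's
`…ClassicalResponseDefs` (p546887: `classicalResponse`, `carrierCl`), `…ClassicalResponseGlue` (p548409: `SplitCl`) and of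
tempered-d1's `…ClassicalResponseTempering` (p554899: the flag-free split `PureSplitCl`), using lane B's uniform Laplace lemma
`DLRPeeling.exists_laplace_bound_of_minimisers_avoid` (ceilings-p2 g6, p576821).  Part 1 of 2 (the sequel `…SemiclassicalScales`
adds translation covariance of the carrier, uniformity in the site, bounded scale ranges and the onset reformulation).

THE QUESTION.  In the v6/v7/v8 architecture of the registered stub `stub_responseMomentsOdd6 : UV → (RM)` the small-field half is
the CLASSICAL SPLIT «`(R⁴/C₁)|kerE^η_β(plane q x) − p q β| ≤ A₀ + carrierCl C_s 1 β R q x η (+ influence)` for EVERY exterior `η`»,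
asked UNIFORMLY in the cube radius `R` along the guard `1 ≤ R`, `R·uRec β ≤ ℓ₁` (so `R → ∞` as `β → ∞`).  Lane B showed (p576821) that the
LARGE-field half (UCR_k) holds at every FIXED level by Laplace's principle and that its content is the level-uniformity.  This file proves
the same for the SMALL-field half, with a twist: at a fixed scale NO large-field term is needed at all.

WHAT IS PROVED (every compact `G`, every lattice representation `r`; nothing is specific to `SU(2)`):
* §1 `kerE_indicator_le_exp_of_minimisers_avoid_on` — lane B's kernel-form Laplace bound with the exteriors restricted to a CLOSED SET
  `Y`: if for every `η ∈ Y` no ground state of the cube with exterior `η` lies in the closed interior event `E`, then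
  `kerE^η_β(1_E) ≤ C e^{−βΔ}` for all `β ≥ 0`, UNIFORMLY on `Y` (a closed set of exteriors is a compact parameter space).
* §2 `kerE_deficit_le_of_classicalResponse_le` — on the LOW-RESPONSE exteriors `{η : classicalResponse_s(η) ≤ δ}` (closed, by the
  continuity of the classical response, p546887) every ground state has centre deficit `≤ δ` (domination, p546887), so for `t > δ` the
  deficit event `{N − plane ≥ t}` (read on the interior links: `plane_glueWith_eq`) is avoided and §1 gives
  `kerE^η_β(N − plane q x) ≤ t + 2N·C·e^{−βΔ}` uniformly on that set.
* §3 **`pureSplit_fixedScale`** — for every `R ≥ 1`, orientation `q`, site `x` and constants `C_s, C₁, A₀ > 0` there is `β₁` with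
  `(R⁴/C₁)|kerE^η_β(plane q x) − N| ≤ A₀ + carrierCl r C_s 1 β R q x η` for ALL `β ≥ β₁` and ALL exteriors `η`: on the low-response set by
  §2; off it the carrier `βR⁴δ/C_s` alone exceeds the trivial bound `2N R⁴/C₁` once `β ≥ 2N C_s/(C₁δ)`.

HONEST READING (numbers, not adjectives).  §3's `β₁(R)` comes from compactness (a finite subcover of `G^{cubeEdges}`, dimension
`3·#cubeEdges ≍ 12(2R+3)⁴` for `SU(2)`) and is INEFFECTIVE; the renormalisation-group content of (split-cl) is exactly an EFFECTIVE onset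
`β₁(R) = O(log R)` (asymptotic freedom of the background-field expansion around the classical minimiser, with the influence functional
excusing the large-field exteriors that §3 excuses by brute force `β → ∞`); the sequel types this as `pureSplitCl_of_onset`.  So, like
(UCR_k) (lane B §4b), the classical split is inhabited scale-by-scale and OPEN only through its uniformity in the scale; nothing here
asserts (split-cl), (GD), (UCR) or anything of E0′; not a gap claim, not Clay.  Folklore: Laplace's principle on a compact fibre (Hwang 1980
Thm 2.1 is the pointwise ancestor, p517756) made uniform on a compact parameter set.
-/

set_option autoImplicit false

noncomputable section

open MeasureTheory Filter Topology Set
open Literature.MathematicalPhysics.QuantumFieldTheory (LatticeRep haarProbability)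
open Literature.MathematicalPhysics.QuantumLattice (LGConfig ymSpecification wilsonBoundaryAction continuous_wilsonBoundaryAction
  continuous_glueWith_prod integral_ymSpecification isProbabilityMeasure_ymSpecification fundamentalLatticeRep fundamentalLatticeRep_N)
open Literature.Probability.LatticeModels
open Summit.QuantumFields.YangMills.Cruxes.OSLegsFromFemtoAndGap.DlrCollarTransfer
open Summit.QuantumFields.YangMills.Cruxes.UVSeamRec.BoundaryLawPenetration (cubeMinimisers cubeMinimisers_nonempty)
open Summit.QuantumFields.YangMills.Cruxes.UVSeamRec.DLRPeeling (exists_laplace_bound_of_minimisers_avoid restrict_glueWith)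
open Summit.QuantumFields.YangMills.Theorems.OSLegsFromFemtoAndGap.StubLower (integrable_of_continuous_compact)

namespace Summit.QuantumFields.YangMills.Cruxes.UVSeamRec.ClassicalResponse

variable {G : Type} [Group G] [TopologicalSpace G] [IsTopologicalGroup G] [CompactSpace G]
  [MeasurableSpace G] [BorelSpace G] (r : LatticeRep G)

/-! ## §1 Laplace's principle for the cube kernels, uniformly on a CLOSED SET of exteriors -/

/-- **Kernel-form Laplace bound on a closed set of exteriors** (lane B's `kerE_indicator_le_exp_of_minimisers_avoid`, p576821, with the
parameter space restricted).  Cube `(c, b)`, a CLOSED set `Y` of exteriors, a closed set `E` of interior configurations such that for every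
`η ∈ Y` no ground state of the cube's boundary Wilson action with exterior `η` lies in `E`.  Then there are `C ≥ 0`, `Δ > 0` with
`kerE^η_{(c,b)}(1_{U|_{cube} ∈ E}) ≤ C·e^{−βΔ}` for all `β ≥ 0` and all `η ∈ Y` (the closed subset `Y` of the compact exterior space is a
compact parameter space for `DLRPeeling.exists_laplace_bound_of_minimisers_avoid`; the kernel is the Haar-product Gibbs measure of the
glued boundary action, tree `integral_ymSpecification`). [folklore] -/
theorem kerE_indicator_le_exp_of_minimisers_avoid_on (c : Fin 4 → ℤ) (b : ℕ) {Y : Set (LGConfig 4 G)} (hY : IsClosed Y)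
    {E : Set (↥(cubeEdges c b) → G)} (hE : IsClosed E)
    (havoid : ∀ η ∈ Y, ∀ ζ ∈ cubeMinimisers G r c b η, ζ ∉ E) :
    ∃ C Δ : ℝ, 0 ≤ C ∧ 0 < Δ ∧ ∀ β : ℝ, 0 ≤ β → ∀ η ∈ Y,
      kerE G r β c b η (({U : LGConfig 4 G | (fun e : ↥(cubeEdges c b) => U e) ∈ E}).indicator fun _ => (1 : ℝ)) ≤
        C * Real.exp (-β * Δ) := by
  classical
  haveI := r.secondCountableTopology
  haveI : CompactSpace ↥Y := isCompact_iff_compactSpace.mp hY.isCompact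
  -- adapted from `DLRPeeling.kernel_le_exp_of_minimisers_avoid` (p576821): same kernel conversion, parameter space `↥Y`
  have h1 : Continuous fun p : ↥Y × (↥(cubeEdges c b) → G) => ((p.1 : LGConfig 4 G), p.2) :=
    (continuous_subtype_val.comp continuous_fst).prodMk continuous_snd
  have hg : Continuous fun p : ↥Y × (↥(cubeEdges c b) → G) => glueWith (cubeEdges c b) p.2 (p.1 : LGConfig 4 G) :=
    ((continuous_glueWith_prod (cubeEdges c b)).comp h1).congr fun _ => rfl
  have hS' : Continuous fun p : ↥Y × (↥(cubeEdges c b) → G) =>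
      wilsonBoundaryAction r.ρ (cubeEdges c b) (glueWith (cubeEdges c b) p.2 (p.1 : LGConfig 4 G)) :=
    ((continuous_wilsonBoundaryAction r.ρ r.continuous (cubeEdges c b)).comp hg).congr fun _ => rfl
  have hS : Continuous ↿(fun (y : ↥Y) (ζ : ↥(cubeEdges c b) → G) =>
      wilsonBoundaryAction r.ρ (cubeEdges c b) (glueWith (cubeEdges c b) ζ (y : LGConfig 4 G))) := hS'
  haveI : IsFiniteMeasure (Measure.pi fun _ : ↥(cubeEdges c b) => haarProbability G) := inferInstance
  haveI : (Measure.pi fun _ : ↥(cubeEdges c b) => haarProbability G).IsOpenPosMeasure := inferInstance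
  obtain ⟨C, Δ, hC, hΔ, hmain⟩ := exists_laplace_bound_of_minimisers_avoid (Y := ↥Y)
    (S := fun (y : ↥Y) (ζ : ↥(cubeEdges c b) → G) =>
      wilsonBoundaryAction r.ρ (cubeEdges c b) (glueWith (cubeEdges c b) ζ (y : LGConfig 4 G)))
    (Measure.pi fun _ : ↥(cubeEdges c b) => haarProbability G) hS hE (fun y ζ h => havoid y.1 y.2 ζ h)
  refine ⟨C, Δ, hC, hΔ, fun β hβ η hη => ?_⟩
  set A : Set (LGConfig 4 G) := {U | (fun e : ↥(cubeEdges c b) => U e) ∈ E} with hAdef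
  have hAm : MeasurableSet A := (measurable_pi_lambda _ fun e => measurable_pi_apply _) hE.measurableSet
  have hFm : Measurable (A.indicator fun _ => (1 : ℝ)) := measurable_const.indicator hAm
  unfold kerE
  rw [integral_ymSpecification r.ρ r.continuous β (cubeEdges c b) hFm]
  have hind : ∀ ζ, A.indicator (fun _ => (1 : ℝ)) (glueWith (cubeEdges c b) ζ η) =
      E.indicator (fun _ => (1 : ℝ)) ζ := by
    intro ζ
    simp only [hAdef, Set.indicator_apply, mem_setOf_eq, restrict_glueWith]
  have hnum : ∫ ζ, A.indicator (fun _ => (1 : ℝ)) (glueWith (cubeEdges c b) ζ η) *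
        Real.exp (-β * wilsonBoundaryAction r.ρ (cubeEdges c b) (glueWith (cubeEdges c b) ζ η))
      ∂(Measure.pi fun _ : ↥(cubeEdges c b) => haarProbability G) =
      ∫ ζ in E, Real.exp (-β * wilsonBoundaryAction r.ρ (cubeEdges c b) (glueWith (cubeEdges c b) ζ η))
      ∂(Measure.pi fun _ : ↥(cubeEdges c b) => haarProbability G) := by
    rw [← integral_indicator hE.measurableSet]
    refine integral_congr_ae (ae_of_all _ fun ζ => ?_)
    show A.indicator (fun _ => (1 : ℝ)) (glueWith (cubeEdges c b) ζ η) *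
        Real.exp (-β * wilsonBoundaryAction r.ρ (cubeEdges c b) (glueWith (cubeEdges c b) ζ η)) =
      E.indicator (fun ζ => Real.exp (-β * wilsonBoundaryAction r.ρ (cubeEdges c b) (glueWith (cubeEdges c b) ζ η))) ζ
    rw [hind ζ]
    by_cases hζ : ζ ∈ E
    · simp only [Set.indicator_of_mem hζ, one_mul]
    · simp only [Set.indicator_of_notMem hζ, zero_mul]
  have hglue : Continuous fun ζ : ↥(cubeEdges c b) → G => glueWith (cubeEdges c b) ζ η :=
    (continuous_glueWith_prod (cubeEdges c b)).comp (Continuous.prodMk_right η)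
  have hSc : Continuous fun ζ : ↥(cubeEdges c b) → G =>
      Real.exp (-β * wilsonBoundaryAction r.ρ (cubeEdges c b) (glueWith (cubeEdges c b) ζ η)) :=
    Real.continuous_exp.comp (continuous_const.mul
      ((continuous_wilsonBoundaryAction r.ρ r.continuous (cubeEdges c b)).comp hglue))
  obtain ⟨B, hB⟩ := (isCompact_univ.image hSc).isBounded.exists_norm_le
  have hint : Integrable (fun ζ : ↥(cubeEdges c b) → G =>
        Real.exp (-β * wilsonBoundaryAction r.ρ (cubeEdges c b) (glueWith (cubeEdges c b) ζ η)))
      (Measure.pi fun _ : ↥(cubeEdges c b) => haarProbability G) := by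
    refine Literature.MathematicalPhysics.QuantumLattice.integrable_of_abs_le hSc.measurable (C := B) fun x => ?_
    rw [← Real.norm_eq_abs]
    exact hB _ (mem_image_of_mem _ (mem_univ x))
  have hZpos : 0 < ∫ ζ, Real.exp (-β * wilsonBoundaryAction r.ρ (cubeEdges c b) (glueWith (cubeEdges c b) ζ η))
      ∂(Measure.pi fun _ : ↥(cubeEdges c b) => haarProbability G) :=
    integral_exp_pos hint
  rw [hnum, div_le_iff₀ hZpos]
  exact hmain β hβ ⟨η, hη⟩

/-! ## §2 The centre plaquette reads interior links; uniform smallness of the kernel's deficit on the low-response exteriors -/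

omit [IsTopologicalGroup G] [CompactSpace G] [BorelSpace G] in
/-- The centre plaquette field of the cube of radius `R+1 ≥ 2` around `x` reads INTERIOR links only: gluing the same interior data into
two exteriors gives the same value (`isCylinder_plane_cube`). [folklore] -/
theorem plane_glueWith_eq {R : ℕ} (hR : 1 ≤ R) (q : Fin 4 × Fin 4) (x : Fin 4 → ℤ)
    (ζ : ↥(cubeEdges (fun k => x k - (R + 1)) (2 * R + 3)) → G) (η η' : LGConfig 4 G) :
    plane G r q x (glueWith (cubeEdges (fun k => x k - (R + 1)) (2 * R + 3)) ζ η) =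
      plane G r q x (glueWith (cubeEdges (fun k => x k - (R + 1)) (2 * R + 3)) ζ η') :=
  isCylinder_plane_cube r hR q x fun e he => by
    rw [glueWith_apply_mem _ _ _ he, glueWith_apply_mem _ _ _ he]

omit [IsTopologicalGroup G] [CompactSpace G] [BorelSpace G] in
/-- The centre plaquette field of `U` equals that of `U`'s interior data glued into ANY exterior. [folklore] -/
theorem plane_eq_plane_glueWith_restrict {R : ℕ} (hR : 1 ≤ R) (q : Fin 4 × Fin 4) (x : Fin 4 → ℤ) (U η : LGConfig 4 G) :
    plane G r q x U =
      plane G r q x (glueWith (cubeEdges (fun k => x k - (R + 1)) (2 * R + 3))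
        (fun e : ↥(cubeEdges (fun k => x k - (R + 1)) (2 * R + 3)) => U e) η) :=
  isCylinder_plane_cube r hR q x fun e he => by rw [glueWith_apply_mem _ _ _ he]

/-- **Uniform smallness of the kernel's centre deficit on the LOW-RESPONSE exteriors.**  Cube of radius `R+1` around `x` (`R ≥ 1`), tilt
`s > 0`, levels `δ < t` with `t ≥ 0`.  There are `C ≥ 0`, `Δ > 0` such that for all `β ≥ 0` and every exterior `η` with
`classicalResponse_s(η) ≤ δ`:  `kerE^η_β(N − plane q x) ≤ t + 2N·C·e^{−βΔ}`.  (On that closed set every ground state has centre deficit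
`≤ classicalResponse_s(η) ≤ δ < t` by p546887's domination, so the closed deficit event `{N − plane ≥ t}` — read on the interior links — is
avoided; §1 bounds its kernel probability, and `N − plane ≤ t + 2N·1_{event}` pointwise.) [folklore] -/
theorem kerE_deficit_le_of_classicalResponse_le {R : ℕ} (hR : 1 ≤ R) (q : Fin 4 × Fin 4) (x : Fin 4 → ℤ) {s δ t : ℝ}
    (hs : 0 < s) (hδt : δ < t) (ht : 0 ≤ t) :
    ∃ C Δ : ℝ, 0 ≤ C ∧ 0 < Δ ∧ ∀ β : ℝ, 0 ≤ β → ∀ η : LGConfig 4 G,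
      classicalResponse r (fun k => x k - (R + 1)) (2 * R + 3) q x s η ≤ δ →
      kerE G r β (fun k => x k - (R + 1)) (2 * R + 3) η (fun U => (r.N : ℝ) - plane G r q x U) ≤
        t + 2 * r.N * (C * Real.exp (-β * Δ)) := by
  classical
  haveI := r.secondCountableTopology
  set Λ := cubeEdges (fun k => x k - (R + 1)) (2 * R + 3) with hΛdef
  set Y : Set (LGConfig 4 G) := {η | classicalResponse r (fun k => x k - (R + 1)) (2 * R + 3) q x s η ≤ δ} with hYdef
  have hY : IsClosed Y := isClosed_le (continuous_classicalResponse _ _ q x s) continuous_const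
  set E : Set (↥Λ → G) := {ζ | t ≤ (r.N : ℝ) - plane G r q x (glueWith Λ ζ 1)} with hEdef
  have hglue1 : Continuous fun ζ : ↥Λ → G => glueWith Λ ζ (1 : LGConfig 4 G) :=
    (continuous_glueWith_prod Λ).comp (Continuous.prodMk_right (1 : LGConfig 4 G))
  have hE : IsClosed E := isClosed_le continuous_const (continuous_const.sub ((continuous_plane r q x).comp hglue1))
  have havoid : ∀ η ∈ Y, ∀ ζ ∈ cubeMinimisers G r (fun k => x k - (R + 1)) (2 * R + 3) η, ζ ∉ E := by
    intro η hη ζ hζ hζE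
    have h1 := deficit_le_classicalResponse (r := r) q x hs hζ
    have h2 : plane G r q x (glueWith Λ ζ 1) = plane G r q x (glueWith Λ ζ η) := plane_glueWith_eq r hR q x ζ 1 η
    have h3 : t ≤ (r.N : ℝ) - plane G r q x (glueWith Λ ζ 1) := hζE
    have h4 : classicalResponse r (fun k => x k - (R + 1)) (2 * R + 3) q x s η ≤ δ := hη
    rw [h2] at h3
    linarith
  obtain ⟨C, Δ, hC, hΔ, hker⟩ := kerE_indicator_le_exp_of_minimisers_avoid_on r _ _ hY hE havoid
  refine ⟨C, Δ, hC, hΔ, fun β hβ η hη => ?_⟩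
  set A : Set (LGConfig 4 G) := {U | (fun e : ↥Λ => U e) ∈ E} with hAdef
  have hA := hker β hβ η hη
  -- pointwise domination `N − plane ≤ t + 2N·1_A`
  have hpt : ∀ U : LGConfig 4 G,
      (r.N : ℝ) - plane G r q x U ≤ t + 2 * r.N * A.indicator (fun _ => (1 : ℝ)) U := by
    intro U
    by_cases hU : U ∈ A
    · rw [Set.indicator_of_mem hU, mul_one]
      linarith [deficit_le_two_mul (r := r) q x U]
    · rw [Set.indicator_of_notMem hU, mul_zero, add_zero]
      have hU' : ¬ t ≤ (r.N : ℝ) - plane G r q x (glueWith Λ (fun e : ↥Λ => U e) 1) := hU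
      rw [← plane_eq_plane_glueWith_restrict r hR q x U 1] at hU'
      exact (not_le.1 hU').le
  -- integrate against the (probability) kernel
  haveI := isProbabilityMeasure_ymSpecification r.ρ r.continuous β Λ η
  have hAm : MeasurableSet A := (measurable_pi_lambda _ fun e => measurable_pi_apply _) hE.measurableSet
  have hIm : Measurable (A.indicator fun _ => (1 : ℝ)) := measurable_const.indicator hAm
  have hIint : Integrable (fun U => t + 2 * r.N * A.indicator (fun _ => (1 : ℝ)) U) (ymSpecification (d := 4) r.ρ β Λ η) := by
    refine (integrable_const t).add ((Literature.MathematicalPhysics.QuantumLattice.integrable_of_abs_le hIm (C := 1)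
      fun U => ?_).const_mul _)
    by_cases hU : U ∈ A
    · simp [Set.indicator_of_mem hU]
    · simp [Set.indicator_of_notMem hU]
  have hdef : Integrable (fun U => (r.N : ℝ) - plane G r q x U) (ymSpecification (d := 4) r.ρ β Λ η) :=
    integrable_of_continuous_compact (continuous_const.sub (continuous_plane r q x))
  have hmono := integral_mono hdef hIint hpt
  have hrhs : ∫ U, t + 2 * r.N * A.indicator (fun _ => (1 : ℝ)) U ∂(ymSpecification (d := 4) r.ρ β Λ η) =
      t + 2 * r.N * kerE G r β (fun k => x k - (R + 1)) (2 * R + 3) η (A.indicator fun _ => (1 : ℝ)) := by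
    unfold kerE
    rw [integral_add (integrable_const t) ((Literature.MathematicalPhysics.QuantumLattice.integrable_of_abs_le hIm (C := 1)
      fun U => ?_).const_mul _), integral_const, smul_eq_mul, probReal_univ, one_mul, integral_const_mul]
    by_cases hU : U ∈ A
    · simp [Set.indicator_of_mem hU]
    · simp [Set.indicator_of_notMem hU]
  have hN : (0 : ℝ) ≤ 2 * r.N := by positivity
  calc kerE G r β (fun k => x k - (R + 1)) (2 * R + 3) η (fun U => (r.N : ℝ) - plane G r q x U)
      ≤ ∫ U, t + 2 * r.N * A.indicator (fun _ => (1 : ℝ)) U ∂(ymSpecification (d := 4) r.ρ β Λ η) := hmono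
    _ = t + 2 * r.N * kerE G r β (fun k => x k - (R + 1)) (2 * R + 3) η (A.indicator fun _ => (1 : ℝ)) := hrhs
    _ ≤ t + 2 * r.N * (C * Real.exp (-β * Δ)) := by gcongr


/-! ## §3 The classical split at a FIXED scale: no large-field term is needed -/

/-- Kernel mean of `p − F` for a continuous `F`: `kerE(p − F) = p − kerE(F)` (the kernel is a probability measure). [folklore] -/
theorem kerE_const_sub (β : ℝ) (c : Fin 4 → ℤ) (b : ℕ) (η : LGConfig 4 G) {F : LGConfig 4 G → ℝ} (hF : Continuous F) (p : ℝ) :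
    kerE G r β c b η (fun U => p - F U) = p - kerE G r β c b η F := by
  haveI := r.secondCountableTopology
  haveI := isProbabilityMeasure_ymSpecification r.ρ r.continuous β (cubeEdges c b) η
  unfold kerE
  rw [integral_sub (integrable_const p) (integrable_of_continuous_compact hF), integral_const, smul_eq_mul,
    probReal_univ, one_mul]

/-- The kernel's centre deficit `kerE^η_β(N − plane q x)` lies in `[0, 2N]`. [folklore] -/
theorem kerE_deficit_mem_Icc (β : ℝ) (c : Fin 4 → ℤ) (b : ℕ) (η : LGConfig 4 G) (q : Fin 4 × Fin 4) (x : Fin 4 → ℤ) :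
    0 ≤ kerE G r β c b η (fun U => (r.N : ℝ) - plane G r q x U) ∧
      kerE G r β c b η (fun U => (r.N : ℝ) - plane G r q x U) ≤ 2 * r.N := by
  refine ⟨?_, ?_⟩
  · unfold kerE
    exact integral_nonneg fun U => deficit_nonneg (r := r) q x U
  · have hM : ∀ U, |(r.N : ℝ) - plane G r q x U| ≤ 2 * r.N := fun U => by
      rw [abs_of_nonneg (deficit_nonneg (r := r) q x U)]
      exact deficit_le_two_mul (r := r) q x U
    exact (le_abs_self _).trans (Summit.QuantumFields.YangMills.Cruxes.NT.BoundaryLaw.abs_kerE_le G r β c b η hM)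

/-- **THE FLAG-FREE CLASSICAL SPLIT AT A FIXED SCALE** (every compact `G`, every lattice representation).  For every cube radius `R ≥ 1`,
orientation `q`, site `x` and constants `C_s, C₁, A₀ > 0` there is an onset `β₁` such that for ALL `β ≥ β₁` and ALL exteriors `η`:
`(R⁴/C₁)·|kerE^η_β(plane q x) − N| ≤ A₀ + carrierCl r C_s 1 β R q x η` — tempered-d1's `PureSplitCl` integrand with reference value
`p q β := N`, at ONE scale, with NO influence functional.  Proof: `t := A₀C₁/(2R⁴)`, `δ := t/2`; on the closed low-response set
`{classicalResponse₁ ≤ δ}` §2 gives `kerE(N − plane) ≤ t + 2N·C·e^{−βΔ} ≤ 2t`, i.e. a left side `≤ A₀`; on its complement the carrier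
`βR⁴·classicalResponse₁/C_s > βR⁴δ/C_s` exceeds the trivial bound `2N·R⁴/C₁` of the left side once `β ≥ 2N·C_s/(C₁δ)`.  The onset
`β₁ = β₁(R, q, x; C_s, C₁, A₀)` is INEFFECTIVE (compactness); the content of (split-cl) is an effective `β₁(R) = O(log R)` (§5). [folklore] -/
theorem pureSplit_fixedScale {R : ℕ} (hR : 1 ≤ R) (q : Fin 4 × Fin 4) (x : Fin 4 → ℤ) {C_s C₁ A₀ : ℝ}
    (hCs : 0 < C_s) (hC₁ : 0 < C₁) (hA₀ : 0 < A₀) :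
    ∃ β₁ : ℝ, ∀ β : ℝ, β₁ ≤ β → ∀ η : LGConfig 4 G,
      (R : ℝ) ^ 4 / C₁ * |kerE G r β (fun k => x k - (R + 1)) (2 * R + 3) η (plane G r q x) - r.N| ≤
        A₀ + carrierCl r C_s 1 β R q x η := by
  have hR4 : (0 : ℝ) < (R : ℝ) ^ 4 := by positivity
  set t : ℝ := A₀ * C₁ / (2 * (R : ℝ) ^ 4) with htdef
  have ht : 0 < t := by positivity
  have hδt : t / 2 < t := by linarith
  obtain ⟨C, Δ, hC, hΔ, hlow⟩ := kerE_deficit_le_of_classicalResponse_le r hR q x one_pos hδt ht.le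
  -- onset (b): the Laplace tail is below `t`
  obtain ⟨β_b, hβ_b⟩ : ∃ β_b : ℝ, ∀ β, β_b ≤ β → 2 * r.N * (C * Real.exp (-β * Δ)) ≤ t := by
    have hneg : Tendsto (fun β : ℝ => -β * Δ) atTop atBot := tendsto_neg_atTop_atBot.atBot_mul_const hΔ
    have hlim : Tendsto (fun β : ℝ => 2 * r.N * (C * Real.exp (-β * Δ))) atTop (𝓝 (2 * r.N * (C * 0))) :=
      tendsto_const_nhds.mul (tendsto_const_nhds.mul (Real.tendsto_exp_atBot.comp hneg))
    rw [mul_zero, mul_zero] at hlim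
    exact (hlim.eventually (Iic_mem_nhds ht)).exists_forall_of_atTop
  refine ⟨max (max β_b 0) (2 * r.N * C_s / (C₁ * (t / 2))), fun β hβ η => ?_⟩
  have hβb : β_b ≤ β := le_trans (le_trans (le_max_left _ _) (le_max_left _ _)) hβ
  have hβ0 : 0 ≤ β := le_trans (le_trans (le_max_right _ _) (le_max_left _ _)) hβ
  have hβa : 2 * r.N * C_s / (C₁ * (t / 2)) ≤ β := le_trans (le_max_right _ _) hβ
  -- the kernel deficit `d ∈ [0, 2N]` and `|kerE(plane) − N| = d`
  set d : ℝ := kerE G r β (fun k => x k - (R + 1)) (2 * R + 3) η (fun U => (r.N : ℝ) - plane G r q x U) with hddef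
  obtain ⟨hd0, hd2⟩ := kerE_deficit_mem_Icc r β (fun k => x k - (R + 1)) (2 * R + 3) η q x
  have habs : |kerE G r β (fun k => x k - (R + 1)) (2 * R + 3) η (plane G r q x) - r.N| = d := by
    rw [hddef, kerE_const_sub r β _ _ η (continuous_plane r q x), abs_sub_comm, abs_of_nonneg]
    rw [← kerE_const_sub r β _ _ η (continuous_plane r q x)]
    exact hd0
  rw [habs]
  have hcar0 : 0 ≤ carrierCl r C_s 1 β R q x η := carrierCl_nonneg hCs one_pos hβ0 R q x η
  by_cases hlowη : classicalResponse r (fun k => x k - (R + 1)) (2 * R + 3) q x 1 η ≤ t / 2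
  · -- low response: Laplace
    have h1 := hlow β hβ0 η hlowη
    have h2 := hβ_b β hβb
    have h3 : d ≤ 2 * t := by rw [hddef]; linarith
    have h4 : (R : ℝ) ^ 4 / C₁ * d ≤ A₀ := by
      calc (R : ℝ) ^ 4 / C₁ * d ≤ (R : ℝ) ^ 4 / C₁ * (2 * t) := by gcongr
        _ = A₀ := by rw [htdef]; field_simp
    linarith
  · -- high response: the carrier dominates
    push Not at hlowη
    have h1 : (R : ℝ) ^ 4 / C₁ * d ≤ (R : ℝ) ^ 4 / C₁ * (2 * r.N) := by gcongr
    have h2 : 2 * r.N * C_s / (C₁ * (t / 2)) * ((R : ℝ) ^ 4 * (t / 2) / C_s) ≤ β * ((R : ℝ) ^ 4 * (t / 2) / C_s) :=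
      mul_le_mul_of_nonneg_right hβa (by positivity)
    have h3 : 2 * r.N * C_s / (C₁ * (t / 2)) * ((R : ℝ) ^ 4 * (t / 2) / C_s) = (R : ℝ) ^ 4 / C₁ * (2 * r.N) := by
      field_simp
    have h4 : β * ((R : ℝ) ^ 4 * (t / 2) / C_s) ≤ carrierCl r C_s 1 β R q x η := by
      unfold carrierCl
      rw [show β * ((R : ℝ) ^ 4 * (t / 2) / C_s) = β * (R : ℝ) ^ 4 / C_s * (t / 2) by ring]
      exact mul_le_mul_of_nonneg_left hlowη.le (by positivity)
    linarith

end Summit.QuantumFields.YangMills.Cruxes.UVSeamRec.ClassicalResponse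

end
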